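import Literature.NumberTheory.Automorphic.Liu2021.AppendixC.Glue
import Literature.AlgebraicGeometry.Morphisms.ClopenPieceOfCoproduct
import Mathlib.AlgebraicGeometry.PullbackCarrier
import HarnessLib

/-!
# Liu 2021 §2.1, Def. 2.1 (1): `∇X'` of a scheme split into geometrically irreducible pieces is covered by the
# self-products of the pieces; uniqueness of `∇X` and of `Alb_X`

Topic `Literature/NumberTheory/Automorphic/Liu2021` (companion of `Liu2021/AlbaneseBaseChange`; consumed by
`Liu2021/AlbaneseBaseChangeProduct`).  PROOF FILE: theorems only — no definition, no named fact, sorry-free (D-0026 ±0).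

[Liu2021] = Yifeng Liu, *Fourier–Jacobi cycles and arithmetic relative trace formula*, Camb. J. Math. **9** (2021) =
arXiv:2102.11518; line numbers `l. NNNN` refer to the author's TeX source `FJcycle.tex` as in `Liu2021/AppendixC/Glue.lean`,
whose structures `AppendixC.Nabla X` (Def. 2.1 (1), l. 1174: «We denote by `∇X` the smallest open and closed subscheme of
`X × X` containing the diagonal `ΔX`») and `AppendixC.Albanese X` (Def. 2.3 with the Proposition before it, l. 1190–1208:
the abelian variety `Alb_X` with `α_X : ∇X → Alb_X` corepresenting `A ↦ {f : ∇X → A | ΔX ⊆ f⁻¹0_A}`) are the objects here.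

## What is proved

Let `L` be a field, `X'` an `L`-scheme, `N : AppendixC.Nabla X'` ANY carrier of `∇X'`, and `inj_c : Y_c ⟶ X'` (`c ∈ κ`)
a family of `L`-morphisms — from `exists_tensorHom_left_eq_incl` on, a COLIMIT cofan in `SchemeOver L = Over (Spec L)`
(`X' ≅ ∐_c Y_c`; its legs are open immersions with disjoint, covering, open and closed images: tree
`Literature/AlgebraicGeometry/Morphisms/ClopenPieceOfCoproduct`, transported to `Over (Spec L)` in §0).

* `range_tensorHom_subset_range_incl`, `exists_lift_tensorHom`: if `Y_c` is geometrically irreducible over `L`, then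
  `inj_c × inj_c : Y_c × Y_c → X' × X'` factors through `∇X' ↪ X' × X'` (its image is the continuous image of the
  irreducible `Y_c ×_L Y_c`, hence preconnected, and meets the open and closed `∇X'` on the diagonal; Mathlib
  `IsPreconnected.subset_isClopen`, `IsOpenImmersion.lift`).
* `exists_tensorHom_left_eq_incl`: for a finite colimit cofan, the `Y_c × Y_c` COVER `∇X'`: the open subscheme of
  `X' × X'` on `U := ⋃_c pr₁⁻¹(Y_c) ∩ pr₂⁻¹(Y_c)` is open AND closed and contains the diagonal, so by the MINIMALITY of `∇X'`
  («the smallest») `∇X' ⊆ U`, and `pr₁⁻¹(Y_c) ∩ pr₂⁻¹(Y_c)` is the image of `Y_c × Y_c` (Mathlib `Scheme.Pullback.range_map`).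
  Together: `∇X' = ∐_c Y_c × Y_c` set-theoretically — Liu's «`∇_{k'}X'`» for the split scheme `X' = ⊔ᵢ Xᵢ` in the proof
  of the Proposition (l. 1194–1200), where `∇Xᵢ = Xᵢ × Xᵢ` for the geometrically connected `Xᵢ`.
* `Nabla.exists_iso`: two carriers of `∇X` are isomorphic over `X × X` (minimality both ways under the monomorphism
  `∇X ↪ X × X`); **`Albanese.nonempty_iso`**: two Albanese data of the same `X` (possibly with different carriers `∇X`)
  have isomorphic Albanese varieties — «the abelian variety that corepresents the functor» (l. 1203) is unique up to
  isomorphism, so statements about `Alb_X` may quantify over ANY datum `a : Albanese X`.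

## Why (cells pub-hodgecm / pub-hodgecm2, TEAM hComp, row A1′)

The named fact `Liu2021.albanese_baseChange_isLimit_fan_jacobian` (`Liu2021/AlbaneseBaseChange.lean`; the `hAlb` leaf of the
COR-CM `hComp` closer) was audited as a COMPOSITE cited fact = (a) Liu's Proposition and its proof + (i) uniqueness of
Albanese data + (ii) Grothendieck's base-change theorem FGA VI 3.3 (iii) + (iii) pointed versus point-free Albanese and the
product decomposition over the components.  This file and `Liu2021/AlbaneseBaseChangeProduct` PROVE (i) and (iii), so that
the cited input shrinks to the one sentence (a)+(ii) «formation of `Alb_X` commutes with extension of the base field»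
(`Liu2021/AlbaneseBaseChangeFact`), from which `albanese_baseChange_isLimit_fan_jacobian` is DERIVED.  Nothing is posited;
no instance, no `variable` beyond binders; no landed file is edited.

## References

* [Liu2021] Y. Liu, arXiv:2102.11518 = Camb. J. Math. 9 (2021): §2.1 Def. 2.1 (1) (l. 1171–1174), Proposition
  (l. 1190–1192) with proof (l. 1194–1200), Def. 2.3 (l. 1202–1208).
* [GortzWedhorn2020] U. Görtz, T. Wedhorn, *Algebraic Geometry I* (2nd ed. 2020), §(3.5) Example 3.11 (coproducts of
  schemes are disjoint unions), Prop. 5.50 (ii) (products with a geometrically irreducible scheme).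
-/

noncomputable section

open CategoryTheory CategoryTheory.Limits AlgebraicGeometry MonoidalCategory CartesianMonoidalCategory
open Literature.AlgebraicGeometry.Motives
open scoped MonObj

universe u

namespace Literature.NumberTheory.Automorphic.Liu2021.AppendixC

variable {L : Type u} [Field L]

/-! ## §0 Scheme-theoretic preliminaries -/

/-- The image of `f × g : X × Y → X' × Y'` (fibre products over `Spec L`) is `pr₁⁻¹(f(X)) ∩ pr₂⁻¹(g(Y))` — Mathlib
`Scheme.Pullback.range_map` read in the cartesian monoidal category `Over (Spec L)` (`Over.tensorHom_left`). [folklore] -/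
private theorem range_tensorHom_left {X Y X' Y' : SchemeOver L} (f : X ⟶ X') (g : Y ⟶ Y') :
    Set.range (f ⊗ₘ g).left = (fst X' Y').left ⁻¹' Set.range f.left ∩
      (snd X' Y').left ⁻¹' Set.range g.left := by
  rw [Over.tensorHom_left]
  exact Scheme.Pullback.range_map _ _ _ _ _ _ _ _ _

/-- The self-product `Y ×_L Y` of a geometrically irreducible `L`-scheme is irreducible (Mathlib's instance for
`pullback f g` with `g` geometrically irreducible and universally open — every morphism to the spectrum of a field is — and
irreducible source; Görtz–Wedhorn I, Prop. 5.50 (ii)). [folklore] -/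
private theorem irreducibleSpace_tensorObj_left (Y : SchemeOver L) [GeometricallyIrreducible Y.hom] :
    IrreducibleSpace ↥(Y ⊗ Y).left := by
  haveI : IrreducibleSpace Y.left := GeometricallyIrreducible.irreducibleSpace_of_subsingleton Y.hom
  change IrreducibleSpace ↥(pullback Y.hom Y.hom)
  infer_instance
section Pieces

universe v

variable {X' : SchemeOver L} {κ : Type v} [Small.{u} κ] {Y : κ → SchemeOver L} {inj : ∀ c, Y c ⟶ X'}

/-- The legs of a colimit cofan `Y_c ⟶ X'` of `L`-schemes are open immersions (tree
`Morphisms.isOpenImmersion_of_isColimit_cofan` through `isColimit_cofan_left`; Görtz–Wedhorn I, Example 3.11). [cite: GortzWedhorn2020, §(3.5) Example 3.11] -/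
theorem isOpenImmersion_left_of_isColimit (hcol : IsColimit (Cofan.mk X' inj)) (c : κ) :
    IsOpenImmersion (inj c).left :=
  Literature.AlgebraicGeometry.Morphisms.isOpenImmersion_of_isColimit_cofan
    (Literature.AlgebraicGeometry.Morphisms.isColimit_cofan_left hcol).some c

/-- The images of the legs of a colimit cofan `Y_c ⟶ X'` of `L`-schemes are open and closed (tree
`Morphisms.isClopen_range_of_isColimit_cofan`; Görtz–Wedhorn I, Example 3.11). [cite: GortzWedhorn2020, §(3.5) Example 3.11] -/
theorem isClopen_range_left_of_isColimit (hcol : IsColimit (Cofan.mk X' inj)) (c : κ) :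
    IsClopen (Set.range (inj c).left) :=
  Literature.AlgebraicGeometry.Morphisms.isClopen_range_of_isColimit_cofan
    (Literature.AlgebraicGeometry.Morphisms.isColimit_cofan_left hcol).some c

/-- Every point of the apex of a colimit cofan `Y_c ⟶ X'` of `L`-schemes lies in the image of some leg (tree
`Morphisms.exists_eq_of_isColimit_cofan`; Görtz–Wedhorn I, Example 3.11). [cite: GortzWedhorn2020, §(3.5) Example 3.11] -/
theorem exists_eq_left_of_isColimit (hcol : IsColimit (Cofan.mk X' inj)) (x : X'.left) :
    ∃ (c : κ) (y : (Y c).left), (inj c).left y = x :=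
  Literature.AlgebraicGeometry.Morphisms.exists_eq_of_isColimit_cofan
    (Literature.AlgebraicGeometry.Morphisms.isColimit_cofan_left hcol).some x

/-- The images of distinct legs of a colimit cofan `Y_c ⟶ X'` of `L`-schemes are disjoint (tree
`Morphisms.pairwise_disjoint_range_of_isColimit_cofan`; Görtz–Wedhorn I, Example 3.11). [cite: GortzWedhorn2020, §(3.5) Example 3.11] -/
theorem disjoint_range_left_of_isColimit (hcol : IsColimit (Cofan.mk X' inj)) {c d : κ} (h : c ≠ d) :
    Disjoint (Set.range (inj c).left) (Set.range (inj d).left) :=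
  Literature.AlgebraicGeometry.Morphisms.pairwise_disjoint_range_of_isColimit_cofan
    (Literature.AlgebraicGeometry.Morphisms.isColimit_cofan_left hcol).some h

/-! ### `∇X'` and the pieces -/

omit [Small.{u} κ] in
/-- **The self-product of a geometrically irreducible piece lies in `∇X'`.**  For `inj_c : Y_c ⟶ X'` with `Y_c`
geometrically irreducible over `L` and any `∇X'` (Def. 2.1 (1): open and closed in `X' × X'`, containing the diagonal),
the image of `inj_c × inj_c : Y_c × Y_c → X' × X'` is contained in `∇X'`: it is the continuous image of the irreducible,
hence connected, `Y_c ×_L Y_c`, it meets `∇X'` (on the diagonal of a point of the non-empty `Y_c`), and a preconnected set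
meeting an open and closed set lies inside it (Mathlib `IsPreconnected.subset_isClopen`).  Ours, the component-wise
reading of «`∇_{k'}X'`» in the proof of the Proposition, l. 1194–1200. [cite: Liu2021, §2.1 Def. 2.1 (1) (l. 1171–1174) and proof of the Proposition (l. 1194–1200)] -/
theorem range_tensorHom_subset_range_incl (N : Nabla X') (c : κ) [GeometricallyIrreducible (Y c).hom] :
    Set.range (inj c ⊗ₘ inj c).left ⊆ Set.range N.incl.left := by
  haveI := N.isOpenImmersion_incl
  haveI := N.isClosedImmersion_incl
  haveI := irreducibleSpace_tensorObj_left (Y c)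
  haveI : IrreducibleSpace (Y c).left :=
    GeometricallyIrreducible.irreducibleSpace_of_subsingleton (Y c).hom
  have hpre : _root_.IsPreconnected (Set.range ⇑(inj c ⊗ₘ inj c).left) :=
    isPreconnected_range (inj c ⊗ₘ inj c).left.continuous
  have hT : IsClopen (Set.range ⇑N.incl.left) :=
    ⟨N.incl.left.isClosedEmbedding.isClosed_range, IsOpenImmersion.isOpen_range N.incl.left⟩
  obtain ⟨y⟩ := (inferInstance : Nonempty (Y c).left)
  refine hpre.subset_isClopen hT ⟨(lift (inj c) (inj c)).left y, ?_, ?_⟩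
  · refine ⟨(lift (𝟙 (Y c)) (𝟙 (Y c))).left y, ?_⟩
    rw [← Scheme.Hom.comp_apply, ← Over.comp_left, lift_map]
    simp
  · refine ⟨N.diag.left ((inj c).left y), ?_⟩
    rw [← Scheme.Hom.comp_apply, ← Scheme.Hom.comp_apply, ← Over.comp_left, ← Over.comp_left,
      N.diag_incl, comp_lift, Category.comp_id]

omit [Small.{u} κ] in
/-- The lift `Y_c × Y_c ⟶ ∇X'` of `inj_c × inj_c` through the open immersion `∇X' ↪ X' × X'` (Mathlib
`IsOpenImmersion.lift` on `range_tensorHom_subset_range_incl`), as a morphism over `Spec L`. [cite: Liu2021, §2.1 Def. 2.1 (1) (l. 1171–1174)] -/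
theorem exists_lift_tensorHom (N : Nabla X') (c : κ) [GeometricallyIrreducible (Y c).hom] :
    ∃ l : Y c ⊗ Y c ⟶ N.N, l ≫ N.incl = inj c ⊗ₘ inj c := by
  haveI := N.isOpenImmersion_incl
  let l₀ := IsOpenImmersion.lift N.incl.left (inj c ⊗ₘ inj c).left
    (range_tensorHom_subset_range_incl N c)
  have hl₀ : l₀ ≫ N.incl.left = (inj c ⊗ₘ inj c).left := IsOpenImmersion.lift_fac _ _ _
  refine ⟨Over.homMk l₀ ?_, ?_⟩
  · rw [← Over.w N.incl, ← Category.assoc, hl₀]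
    exact Over.w _
  · exact Over.OverMorphism.ext hl₀

/-- **The pieces `Y_c × Y_c` cover `∇X'`.**  For a colimit cofan `inj_c : Y_c ⟶ X'` (finite `κ`) and any `∇X'`, every
point of `∇X'` maps into the image of some `inj_c × inj_c`.  PROOF: `U := ⋃_c pr₁⁻¹(inj_c(Y_c)) ∩ pr₂⁻¹(inj_c(Y_c))` is
open and closed in `X' × X'` (finite union; the images of the legs are open and closed) and contains the diagonal (the
legs cover `X'`), so the open subscheme on `U` is an open and closed subscheme of `X' × X'` through which the diagonal
factors; by the MINIMALITY of `∇X'` (Def. 2.1 (1): «the smallest») `∇X' ↪ X' × X'` factors through it, i.e. `∇X' ⊆ U`;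
and `pr₁⁻¹(inj_c(Y_c)) ∩ pr₂⁻¹(inj_c(Y_c))` is the image of `inj_c × inj_c` (`range_tensorHom_left`). [cite: Liu2021, §2.1 Def. 2.1 (1) (l. 1171–1174) and proof of the Proposition (l. 1194–1200)] -/
theorem exists_tensorHom_left_eq_incl [Finite κ] (N : Nabla X') (hcol : IsColimit (Cofan.mk X' inj))
    (n : N.N.left) :
    ∃ (c : κ) (z : (Y c ⊗ Y c).left), (inj c ⊗ₘ inj c).left z = N.incl.left n := by
  haveI := N.isOpenImmersion_incl
  set R : κ → Set X'.left := fun c => Set.range (inj c).left with hR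
  set U : Set ↥(X' ⊗ X').left :=
    ⋃ c, ⇑(fst X' X').left ⁻¹' R c ∩ ⇑(snd X' X').left ⁻¹' R c with hU
  have hRc : ∀ c, IsClopen (R c) := fun c => isClopen_range_left_of_isColimit hcol c
  have hUo : IsOpen U := isOpen_iUnion fun c =>
    ((hRc c).2.preimage (fst X' X').left.continuous).inter
      ((hRc c).2.preimage (snd X' X').left.continuous)
  have hUc : IsClosed U := isClosed_iUnion_of_finite fun c =>
    ((hRc c).1.preimage (fst X' X').left.continuous).inter
      ((hRc c).1.preimage (snd X' X').left.continuous)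
  obtain ⟨Uo, hUo_range⟩ : ∃ Uo : (X' ⊗ X').left.Opens, Set.range ⇑Uo.ι = U :=
    ⟨⟨U, hUo⟩, Scheme.Opens.range_ι _⟩
  let W : SchemeOver L := Over.mk (Uo.ι ≫ (X' ⊗ X').hom)
  let j : W ⟶ X' ⊗ X' := Over.homMk Uo.ι rfl
  have hjo : IsOpenImmersion Uo.ι := inferInstance
  have hjc : IsClosedImmersion Uo.ι :=
    IsClosedImmersion.of_isPreimmersion Uo.ι (by rw [hUo_range]; exact hUc)
  -- the diagonal lands in `U`
  have hdiag : Set.range ⇑(lift (𝟙 X') (𝟙 X')).left ⊆ Set.range ⇑Uo.ι := by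
    rw [hUo_range]
    rintro _ ⟨x, rfl⟩
    obtain ⟨c, y, hy⟩ := exists_eq_left_of_isColimit hcol x
    refine Set.mem_iUnion.mpr ⟨c, ?_, ?_⟩
    · show (fst X' X').left ((lift (𝟙 X') (𝟙 X')).left x) ∈ R c
      rw [← Scheme.Hom.comp_apply, ← Over.comp_left, lift_fst]
      exact ⟨y, hy⟩
    · show (snd X' X').left ((lift (𝟙 X') (𝟙 X')).left x) ∈ R c
      rw [← Scheme.Hom.comp_apply, ← Over.comp_left, lift_snd]
      exact ⟨y, hy⟩
  have hδ : ∃ δ : X' ⟶ W, δ ≫ j = lift (𝟙 X') (𝟙 X') := by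
    let d₀ := IsOpenImmersion.lift Uo.ι (lift (𝟙 X') (𝟙 X')).left hdiag
    have hd₀ : d₀ ≫ Uo.ι = (lift (𝟙 X') (𝟙 X')).left := IsOpenImmersion.lift_fac _ _ _
    refine ⟨Over.homMk d₀ ?_, ?_⟩
    · change d₀ ≫ Uo.ι ≫ (X' ⊗ X').hom = X'.hom
      rw [← Category.assoc, hd₀]
      exact Over.w (lift (𝟙 X') (𝟙 X'))
    · exact Over.OverMorphism.ext hd₀
  obtain ⟨f, hf⟩ := N.minimal W j hjo hjc hδ
  have hn : N.incl.left n ∈ U := by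
    rw [← hUo_range]
    refine ⟨f.left n, ?_⟩
    have hf' : f.left ≫ Uo.ι = N.incl.left := by rw [← hf]; rfl
    have happ := Scheme.Hom.comp_apply f.left Uo.ι n
    rw [hf'] at happ
    exact happ.symm
  obtain ⟨c, hc⟩ := Set.mem_iUnion.mp hn
  refine ⟨c, ?_⟩
  have : N.incl.left n ∈ Set.range ⇑(inj c ⊗ₘ inj c).left := by
    rw [range_tensorHom_left]
    exact hc
  exact this

end Pieces

/-! ## Uniqueness of `∇X` and of `Alb_X` -/

section Unique

variable {X : SchemeOver L}

/-- **`∇X` is unique**: two carriers of Def. 2.1 (1) («the smallest open and closed subscheme of `X × X` containing the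
diagonal») are isomorphic over `X × X` — minimality of each against the other gives mutually inverse morphisms under the
monomorphism `∇X ↪ X × X`.  Ours (sanity of the carrier typing of `AppendixC/Glue.lean`). [cite: Liu2021, §2.1 Def. 2.1 (1) (l. 1171–1174)] -/
theorem Nabla.exists_iso (N₁ N₂ : Nabla X) : ∃ e : N₁.N ≅ N₂.N, e.hom ≫ N₂.incl = N₁.incl := by
  haveI := N₁.isOpenImmersion_incl
  haveI := N₂.isOpenImmersion_incl
  obtain ⟨f, hf⟩ := N₁.minimal N₂.N N₂.incl N₂.isOpenImmersion_incl N₂.isClosedImmersion_incl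
    ⟨N₂.diag, N₂.diag_incl⟩
  obtain ⟨g, hg⟩ := N₂.minimal N₁.N N₁.incl N₁.isOpenImmersion_incl N₁.isClosedImmersion_incl
    ⟨N₁.diag, N₁.diag_incl⟩
  haveI : Mono N₁.incl := Over.mono_of_mono_left _
  haveI : Mono N₂.incl := Over.mono_of_mono_left _
  refine ⟨⟨f, g, ?_, ?_⟩, hf⟩
  · rw [← cancel_mono N₁.incl, Category.assoc, hg, hf, Category.id_comp]
  · rw [← cancel_mono N₂.incl, Category.assoc, hf, hg, Category.id_comp]

/-- **`Alb_X` is unique up to isomorphism**: two Albanese data of the same `k`-scheme `X` in the sense of Def. 2.3 (possibly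
with different carriers `∇X`) have isomorphic Albanese varieties — «the abelian variety that corepresents the functor
`\underline{Alb}_X`» (l. 1203) is determined up to isomorphism; the isomorphism is `a₁.desc (e ≫ α₂)` for the isomorphism
`e : ∇₁X ≅ ∇₂X` of `Nabla.exists_iso`.  Hence statements about `Alb_X` may quantify over ANY datum `a : Albanese X`.
Ours, from `desc`/`fac`/`uniq`. [cite: Liu2021, §2.1 Proposition (l. 1190–1192) and Def. 2.3 (l. 1202–1208)] -/
theorem Albanese.nonempty_iso (a₁ a₂ : Albanese X) : Nonempty (a₁.Alb ≅ a₂.Alb) := by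
  obtain ⟨e, he⟩ := Nabla.exists_iso a₁.nabla a₂.nabla
  have hdiag : a₁.nabla.diag ≫ e.hom = a₂.nabla.diag := by
    haveI := a₂.nabla.isOpenImmersion_incl
    haveI : Mono a₂.nabla.incl := Over.mono_of_mono_left _
    rw [← cancel_mono a₂.nabla.incl, Category.assoc, he, a₁.nabla.diag_incl, a₂.nabla.diag_incl]
  have hdiag' : a₂.nabla.diag ≫ e.inv = a₁.nabla.diag := by
    rw [← hdiag, Category.assoc, e.hom_inv_id, Category.comp_id]
  have h₁ : a₁.nabla.diag ≫ e.hom ≫ a₂.α = 1 := by rw [← Category.assoc, hdiag, a₂.diag_α]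
  have h₂ : a₂.nabla.diag ≫ e.inv ≫ a₁.α = 1 := by rw [← Category.assoc, hdiag', a₁.diag_α]
  refine ⟨⟨a₁.desc (e.hom ≫ a₂.α) h₁, a₂.desc (e.inv ≫ a₁.α) h₂, ?_, ?_⟩⟩
  · apply a₁.hom_ext
    change a₁.α ≫ (a₁.desc _ h₁).hom.hom.hom ≫ (a₂.desc _ h₂).hom.hom.hom = a₁.α ≫ 𝟙 _
    rw [← Category.assoc, a₁.fac, Category.assoc, a₂.fac, e.hom_inv_id_assoc, Category.comp_id]
  · apply a₂.hom_ext
    change a₂.α ≫ (a₂.desc _ h₂).hom.hom.hom ≫ (a₁.desc _ h₁).hom.hom.hom = a₂.α ≫ 𝟙 _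
    rw [← Category.assoc, a₂.fac, Category.assoc, a₁.fac, e.inv_hom_id_assoc, Category.comp_id]

end Unique

end Literature.NumberTheory.Automorphic.Liu2021.AppendixC

end
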